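import Literature.NumberTheory.LFunctions.LagariasRains2003.Refutation
import Literature.NumberTheory.LFunctions.LagariasRains2003.CornerCertificate
import HarnessLib

/-!
# Lagarias–Rains (2003), §7.3 Question 1 — the corner point `(−16, −1/20 + i)`

[LagariasRains2003, §7.3 Question 1] asks whether `Re Z_ℚ(w, s) > 0` on the whole cone
`C⁻ = {(w, s) : w = u ∈ ℝ, u < Re s < 0}`; `LagariasRains2003.Refutation` answers it in the negative
at `(−16, −1/100 + i)`. This file certifies a second point of `C⁻`, the corner point
`(w, s) = (−16, −1/20 + i)`: `Re Z_ℚ(−16, −1/20 + i) < 0` (`re_ZQ_corner_lt_zero`; numerically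
`Re Z_ℚ = −0.0450…`).

Proof, exactly as in `LagariasRains2003.Refutation`. By Theorem 2.1 (`ZQ_eq`),
`Re Z_ℚ(−16, −1/20 + i) = 20/401 + 6380/102161 − ∫_1^∞ h_c`,
`h_c(t) = (1 − θ(t²)^{−16})(t^{−21/20} + t^{−339/20}) cos(log t)` (`re_PhiC`); on `[1, 2]` the three
factors are non-negative and non-increasing, so `∫_1^2 h_c` dominates the right-endpoint Riemann sum
with 64 nodes, which the kernel certificate `certCorner_true` bounds below by
`20/401 + 6380/102161 + 1/1000` (`certCorner_sound`), and `|∫_2^∞ Re Φ_c| ≤ ∫_2^∞ 128 e^{−2πt} < 1/1000`.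
Standard axioms only (`decide +kernel` in `LagariasRains2003.CornerCertificate`).
-/

open MeasureTheory Set Filter Topology Complex
open Literature.Analysis.ValidatedNumerics Literature.Analysis.ValidatedNumerics.NumericsMP

namespace Literature.NumberTheory.LFunctions.LagariasRains2003

/-! ## The corner point and its real integrand `h_c` -/

/-- `s_c = −1/20 + i`. [cite: LagariasRains2003, §7.3 Question 1] -/
noncomputable def sCorner : ℂ := ⟨-1 / 20, 1⟩

/-- `(−16, s_c) ∈ C⁻`. [cite: LagariasRains2003, §7.3 Question 1] -/
theorem corner_mem_coneMinus : (wPt, sCorner) ∈ coneMinus :=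
  ⟨-16, by simp [wPt], by norm_num [sCorner], by norm_num [sCorner]⟩

/-- `t^{−21/20} + t^{−339/20}`. [cite: LagariasRains2003, §7.3 Question 1] -/
noncomputable def facBC (t : ℝ) : ℝ := t ^ (-(21 / 20) : ℝ) + t ^ (-(339 / 20) : ℝ)

/-- `h_c(t) = (1 − θ(t²)^{−16})(t^{−21/20} + t^{−339/20}) cos(log t) = −Re Φ_c(t)`.
[cite: LagariasRains2003, §7.3 Question 1] -/
noncomputable def hfunC (t : ℝ) : ℝ := facA t * facBC t * facC t

/-- The integrand of Theorem 2.1 at `(−16, s_c)`. [cite: LagariasRains2003, Thm. 2.1] -/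
noncomputable def PhiC (t : ℝ) : ℂ :=
  ((theta (t ^ 2) : ℂ) ^ wPt - 1) * ((t : ℂ) ^ (sCorner - 1) + (t : ℂ) ^ (wPt - sCorner - 1))

/-- `Re t^z = cos(Im z · log t) · t^{Re z}` for `t > 0`. [folklore] -/
private theorem re_cpow_ofReal_eq {t : ℝ} (ht : 0 < t) (z : ℂ) :
    ((t : ℂ) ^ z).re = Real.cos (z.im * Real.log t) * t ^ z.re := by
  rw [cpow_def_of_ne_zero (ofReal_ne_zero.mpr ht.ne'), ← ofReal_log ht.le, exp_re, re_ofReal_mul,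
    im_ofReal_mul, Real.rpow_def_of_pos ht, mul_comm z.im, mul_comm]

/-- `θ(t²)^{w₀} − 1 = (θ(t²)^16)⁻¹ − 1`, a real number. [folklore] -/
private theorem thetaSq_cpow_wPt_sub_one (t : ℝ) :
    (theta (t ^ 2) : ℂ) ^ wPt - 1 = (((theta (t ^ 2) ^ 16)⁻¹ - 1 : ℝ) : ℂ) := by
  have : (wPt : ℂ) = -((16 : ℕ) : ℂ) := by simp [wPt]
  rw [this, cpow_neg, cpow_natCast]
  push_cast
  rfl

/-- `Re Φ_c(t) = −h_c(t)` for `t > 0`. [cite: LagariasRains2003, §7.3 Question 1] -/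
theorem re_PhiC {t : ℝ} (ht : 0 < t) : (PhiC t).re = -hfunC t := by
  unfold PhiC hfunC facA facBC facC
  rw [thetaSq_cpow_wPt_sub_one t, re_ofReal_mul, add_re, re_cpow_ofReal_eq ht, re_cpow_ofReal_eq ht]
  have h1 : (sCorner - 1).re = -(21 / 20) := by norm_num [sCorner]
  have h2 : (sCorner - 1).im = 1 := by norm_num [sCorner]
  have h3 : (wPt - sCorner - 1).re = -(339 / 20) := by norm_num [sCorner, wPt]
  have h4 : (wPt - sCorner - 1).im = -1 := by norm_num [sCorner, wPt]
  rw [h1, h2, h3, h4, one_mul, neg_one_mul, Real.cos_neg]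
  ring

/-! ## `h_c` is non-negative and non-increasing on `[1, 2]` -/

/-- `t ↦ 1 − θ(t²)^{−16}` is non-negative and non-increasing on `(0, ∞)`. [folklore] -/
private theorem facA_anti_nonneg {a b : ℝ} (ha : 0 < a) (hab : a ≤ b) :
    facA b ≤ facA a ∧ 0 ≤ facA a := by
  unfold facA
  have hb : 0 < b := lt_of_lt_of_le ha hab
  have hθ : theta (b ^ 2) ≤ theta (a ^ 2) :=
    theta_antitoneOn (show a ^ 2 ∈ Ioi 0 by simp only [mem_Ioi]; positivity)
      (show b ^ 2 ∈ Ioi 0 by simp only [mem_Ioi]; positivity) (pow_le_pow_left₀ ha.le hab 2)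
  have hθb : 0 < theta (b ^ 2) := theta_pos (by positivity)
  have h16 : theta (b ^ 2) ^ 16 ≤ theta (a ^ 2) ^ 16 := pow_le_pow_left₀ hθb.le hθ 16
  have h1 := inv_anti₀ (pow_pos hθb 16) h16
  have h2 := inv_le_one_of_one_le₀ (one_le_pow₀ (M₀ := ℝ) (one_le_theta (show 0 < a ^ 2 by positivity))
    (n := 16))
  constructor <;> linarith

/-- `t ↦ t^{−21/20} + t^{−339/20}` is non-negative and non-increasing on `(0, ∞)`. [folklore] -/
private theorem facBC_anti_nonneg {a b : ℝ} (ha : 0 < a) (hab : a ≤ b) :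
    facBC b ≤ facBC a ∧ 0 ≤ facBC b :=
  ⟨add_le_add (Real.rpow_le_rpow_of_nonpos ha hab (by norm_num))
    (Real.rpow_le_rpow_of_nonpos ha hab (by norm_num)),
   add_nonneg (Real.rpow_nonneg (ha.le.trans hab) _) (Real.rpow_nonneg (ha.le.trans hab) _)⟩

/-- `log t < 7/10` for `0 < t ≤ 2`. [folklore] -/
private theorem log_lt_of_le_two {t : ℝ} (h0 : 0 < t) (h2 : t ≤ 2) : Real.log t < 7 / 10 :=
  (Real.log_le_log h0 h2).trans_lt (by linarith [Real.log_two_lt_d9])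

/-- `t ↦ cos (log t)` is non-negative and non-increasing on `[1, 2]`. [folklore] -/
private theorem facC_anti_nonneg {a b : ℝ} (ha : 1 ≤ a) (hab : a ≤ b) (hb : b ≤ 2) :
    facC b ≤ facC a ∧ 0 ≤ facC b := by
  unfold facC
  have hlb := log_lt_of_le_two (by linarith) hb
  refine ⟨Real.cos_le_cos_of_nonneg_of_le_pi (Real.log_nonneg ha)
    (by linarith [Real.pi_gt_three]) (Real.log_le_log (by linarith) hab),
    Real.cos_nonneg_of_mem_Icc ⟨?_, ?_⟩⟩
  · linarith [Real.log_nonneg (ha.trans hab), Real.pi_pos]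
  · linarith [Real.pi_gt_three]

/-- `h_c ≥ 0` on `[1, 2]`. [cite: LagariasRains2003, §7.3 Question 1] -/
theorem hfunC_nonneg {t : ℝ} (h1 : 1 ≤ t) (h2 : t ≤ 2) : 0 ≤ hfunC t :=
  mul_nonneg (mul_nonneg (facA_anti_nonneg (by linarith : (0 : ℝ) < t) le_rfl).2
    (facBC_anti_nonneg (by linarith : (0 : ℝ) < t) le_rfl).2) (facC_anti_nonneg h1 le_rfl h2).2

/-- `h_c` is non-increasing on `[1, 2]`. [cite: LagariasRains2003, §7.3 Question 1] -/
theorem hfunC_antitoneOn : AntitoneOn hfunC (Icc 1 2) := by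
  intro a ha b hb hab
  simp only [mem_Icc] at ha hb
  unfold hfunC
  have ha0 : 0 < a := by linarith
  have hA := facA_anti_nonneg ha0 hab
  have hB := facBC_anti_nonneg ha0 hab
  have hBa := (facBC_anti_nonneg ha0 le_rfl).2
  have hC := facC_anti_nonneg ha.1 hab hb.2
  exact mul_le_mul (mul_le_mul hA.1 hB.1 hB.2 hA.2) hC.1 hC.2 (mul_nonneg hA.2 hBa)

/-- Right-endpoint Riemann sum with 64 nodes: `Σ_{i<64} h_c(1 + (i+1)/64) ≤ 64 ∫_1^2 h_c`.
[cite: LagariasRains2003, §7.3 Question 1] -/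
theorem sum_le_integral_hfunC :
    ∑ i ∈ Finset.range 64, hfunC (1 + ((i : ℝ) + 1) / 64) ≤ 64 * ∫ t in (1 : ℝ)..2, hfunC t := by
  have hanti : AntitoneOn (fun u : ℝ => hfunC (u / 64 + 1)) (Icc (0 : ℝ) ((0 : ℝ) + (64 : ℕ))) := by
    intro u hu v hv huv
    simp only [mem_Icc] at hu hv
    push_cast at hu hv
    exact hfunC_antitoneOn ⟨by linarith, by linarith⟩ ⟨by linarith, by linarith⟩ (by linarith)
  have h1 := AntitoneOn.sum_le_integral hanti
  have h2 : ∫ x in (0 : ℝ)..(0 : ℝ) + (64 : ℕ), hfunC (x / 64 + 1) =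
      64 * ∫ t in (1 : ℝ)..2, hfunC t := by
    rw [intervalIntegral.integral_comp_div_add (fun t => hfunC t) (by norm_num : (64 : ℝ) ≠ 0) 1]
    norm_num
  rw [h2] at h1
  convert h1 using 2 with i _
  push_cast
  ring_nf

/-! ## The tail `t ≥ 2` -/

/-- `1 − u^{−16} ≤ 16 u − 16` for `u ≥ 1`. [folklore] -/
private theorem one_sub_inv_pow_sixteen_le {u : ℝ} (hu : 1 ≤ u) : 1 - (u ^ 16)⁻¹ ≤ 16 * u - 16 := by
  have hu0 : 0 < u := by linarith
  have h1 : (u ^ 16)⁻¹ = Real.exp (-(16 * Real.log u)) := by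
    rw [Real.exp_neg, show (16 : ℝ) * Real.log u = (16 : ℕ) * Real.log u by norm_num,
      Real.exp_nat_mul, Real.exp_log hu0]
  have h2 : -(16 * Real.log u) + 1 ≤ Real.exp (-(16 * Real.log u)) := Real.add_one_le_exp _
  have h3 : Real.log u ≤ u - 1 := Real.log_le_sub_one_of_pos hu0
  rw [h1]
  linarith

/-- For `t ≥ 2`: `|Φ_c(t)| ≤ 128 e^{−2πt}`. [cite: LagariasRains2003, §7.3 Question 1] -/
theorem norm_PhiC_le {t : ℝ} (ht : 2 ≤ t) : ‖PhiC t‖ ≤ 128 * Real.exp (-(2 * Real.pi) * t) := by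
  have ht0 : 0 < t := by linarith
  have hT : 0 < t ^ 2 := by positivity
  set r := Real.exp (-Real.pi * t ^ 2) with hr
  have hr0 : 0 < r := Real.exp_pos _
  have hr1 : r ≤ 1 / 13 := by
    have h12 : (13 : ℝ) ≤ Real.exp 12 := by linarith [Real.add_one_le_exp (12 : ℝ)]
    have : r ≤ Real.exp (-12) := Real.exp_le_exp.mpr (by nlinarith [Real.pi_gt_three])
    rw [Real.exp_neg] at this
    exact this.trans (by rw [inv_eq_one_div]; exact one_div_le_one_div_of_le (by norm_num) h12)
  have hθ1 : theta (t ^ 2) - 1 ≤ 4 * r := by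
    have := theta_sub_one_le hT
    rw [← hr] at this
    refine this.trans ?_
    rw [div_le_iff₀ (by linarith)]
    nlinarith
  have hθge : 1 ≤ theta (t ^ 2) := one_le_theta hT
  have hF1 : ‖(theta (t ^ 2) : ℂ) ^ wPt - 1‖ ≤ 64 * r := by
    rw [thetaSq_cpow_wPt_sub_one t, norm_real, Real.norm_eq_abs,
      abs_of_nonpos (by
        have := inv_le_one_of_one_le₀ (one_le_pow₀ (M₀ := ℝ) hθge (n := 16)); linarith)]
    have := one_sub_inv_pow_sixteen_le hθge
    linarith
  have hF2 : ‖(t : ℂ) ^ (sCorner - 1) + (t : ℂ) ^ (wPt - sCorner - 1)‖ ≤ 2 := by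
    refine (norm_add_le _ _).trans ?_
    have ht1 : (1 : ℝ) ≤ t := by linarith
    have h1 : ‖(t : ℂ) ^ (sCorner - 1)‖ ≤ 1 := by
      rw [norm_cpow_eq_rpow_re_of_pos ht0]
      exact Real.rpow_le_one_of_one_le_of_nonpos ht1 (by norm_num [sCorner])
    have h2 : ‖(t : ℂ) ^ (wPt - sCorner - 1)‖ ≤ 1 := by
      rw [norm_cpow_eq_rpow_re_of_pos ht0]
      exact Real.rpow_le_one_of_one_le_of_nonpos ht1 (by norm_num [sCorner, wPt])
    linarith
  have hexp : r ≤ Real.exp (-(2 * Real.pi) * t) := by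
    refine Real.exp_le_exp.mpr ?_
    have h2t : 2 * t ≤ t ^ 2 := by nlinarith
    have := mul_le_mul_of_nonneg_left h2t Real.pi_pos.le
    linarith
  calc ‖PhiC t‖ = ‖(theta (t ^ 2) : ℂ) ^ wPt - 1‖ *
        ‖(t : ℂ) ^ (sCorner - 1) + (t : ℂ) ^ (wPt - sCorner - 1)‖ := norm_mul _ _
    _ ≤ 64 * r * 2 := mul_le_mul hF1 hF2 (norm_nonneg _) (by positivity)
    _ ≤ 128 * Real.exp (-(2 * Real.pi) * t) := by nlinarith

/-- `∫_2^∞ Re Φ_c < 1/1000`. [cite: LagariasRains2003, §7.3 Question 1] -/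
theorem integral_tail_PhiC_lt :
    ∫ t in Ioi (2 : ℝ), (PhiC t).re < 1 / 1000 := by
  have hws : wPt.re < sCorner.re := by norm_num [wPt, sCorner]
  have hs : sCorner.re < 0 := by norm_num [sCorner]
  have h3 : IntegrableOn PhiC (Ioi 1) := integrableOn_thetaPowSubOne_mul hws hs
  have hint : IntegrableOn (fun t => (PhiC t).re) (Ioi 2) :=
    (h3.mono_set (Ioi_subset_Ioi (by norm_num))).re
  have hg : IntegrableOn (fun t : ℝ => 128 * Real.exp (-(2 * Real.pi) * t)) (Ioi 2) :=
    (exp_neg_integrableOn_Ioi 2 (by positivity)).const_mul 128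
  have hle : ∫ t in Ioi (2 : ℝ), (PhiC t).re ≤
      ∫ t in Ioi (2 : ℝ), 128 * Real.exp (-(2 * Real.pi) * t) :=
    setIntegral_mono_on hint hg measurableSet_Ioi fun t ht =>
      (re_le_norm _).trans (norm_PhiC_le (le_of_lt ht))
  have hval : ∫ t in Ioi (2 : ℝ), 128 * Real.exp (-(2 * Real.pi) * t) =
      128 * (Real.exp (-(2 * Real.pi) * 2) / (2 * Real.pi)) := by
    rw [integral_const_mul, integral_exp_mul_Ioi (by linarith [Real.pi_pos]) 2]
    congr 1
    field_simp
  have hexp : Real.exp (-(2 * Real.pi) * 2) ≤ 1 / 150000 := by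
    have h1 : Real.exp (-(2 * Real.pi) * 2) ≤ Real.exp (-12) :=
      Real.exp_le_exp.mpr (by linarith [Real.pi_gt_three])
    have h2 : (150000 : ℝ) ≤ Real.exp 12 := by
      have h := pow_le_pow_left₀ (by norm_num) (le_of_lt Real.exp_one_gt_d9) 12
      rw [Real.exp_one_pow] at h
      exact le_trans (by norm_num) h
    rw [Real.exp_neg] at h1
    exact h1.trans (by rw [inv_eq_one_div]; exact one_div_le_one_div_of_le (by norm_num) h2)
  have hpi : 1 / (2 * Real.pi) ≤ 1 / 6 :=
    one_div_le_one_div_of_le (by norm_num) (by linarith [Real.pi_gt_three])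
  calc ∫ t in Ioi (2 : ℝ), (PhiC t).re ≤ 128 * (Real.exp (-(2 * Real.pi) * 2) / (2 * Real.pi)) := by
        rw [← hval]; exact hle
    _ = 128 * (Real.exp (-(2 * Real.pi) * 2) * (1 / (2 * Real.pi))) := by ring
    _ ≤ 128 * ((1 / 150000) * (1 / 6)) := by
        gcongr
    _ < 1 / 1000 := by norm_num

/-! ## Soundness of the corner-point kernel certificate -/

/-- `0 < PREC` in `ℕ` and in `ℝ`. [folklore] -/
private theorem PREC_pos_pair : 0 < PREC ∧ (0 : ℝ) < (PREC : ℝ) := by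
  refine ⟨by unfold PREC; positivity, ?_⟩
  exact_mod_cast (show 0 < PREC by unfold PREC; positivity)

/-- Integer division rounds down: `↑(x / y) ≤ ↑x · (↑y)⁻¹` for `y > 0`. [folklore] -/
private theorem cast_ediv_le_mul_inv (x : ℤ) {y : ℤ} (hy : 0 < y) :
    ((x / y : ℤ) : ℝ) ≤ (x : ℝ) * (y : ℝ)⁻¹ := by
  rw [← div_eq_mul_inv, le_div_iff₀ (by exact_mod_cast hy)]
  exact_mod_cast Int.ediv_mul_le x hy.ne'

/-- `0 ≤ ↑(max x 0) ≤ y` from `↑x ≤ y` and `0 ≤ y`. [folklore] -/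
private theorem cast_max_zero_mem {x : ℤ} {y : ℝ} (h : (x : ℝ) ≤ y) (hy : 0 ≤ y) :
    0 ≤ max x 0 ∧ ((max x 0 : ℤ) : ℝ) ≤ y := by
  refine ⟨le_max_right _ _, ?_⟩
  rw [Int.cast_max, Int.cast_zero]; exact max_le h hy

/-- `logRatio n ∋ log n − log 64`. [folklore] -/
private theorem logRatio_mem {n : ℕ} {L : MI} (h : logRatio n = some L) :
    MI.mem PREC (Real.log (n : ℝ) - Real.log ((64 : ℕ) : ℝ)) L := by
  unfold logRatio at h
  split at h
  · rename_i A B hA hB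
    simp only [Option.some.injEq] at h
    subst h
    exact MI.mem_sub (MI.mem_logNat PREC_pos_pair.1 hA) (MI.mem_logNat PREC_pos_pair.1 hB)
  · simp at h

/-- Soundness of `nodePartsC`. [folklore] -/
private theorem nodePartsC_sound {P : MI} (hP : MI.mem PREC Real.pi P) {n : ℕ} (hn1 : 64 ≤ n)
    (hn2 : n ≤ 128) {a b c : ℤ} (h : nodePartsC P n = some (a, b, c)) :
    (0 ≤ a ∧ (a : ℝ) ≤ facA ((n : ℝ) / 64) * PREC) ∧ (0 ≤ b ∧ (b : ℝ) ≤ facBC ((n : ℝ) / 64) * PREC) ∧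
      (0 ≤ c ∧ (c : ℝ) ≤ facC ((n : ℝ) / 64) * PREC) := by
  have hS := PREC_pos_pair.1
  have hSr := PREC_pos_pair.2
  have hn : 0 < n := by omega
  set t : ℝ := (n : ℝ) / 64 with ht
  have ht1 : 1 ≤ t := by
    rw [ht, le_div_iff₀ (by norm_num)]; exact_mod_cast (show 1 * 64 ≤ n by omega)
  have ht2 : t ≤ 2 := by
    rw [ht, div_le_iff₀ (by norm_num)]; exact_mod_cast (show n ≤ 2 * 64 by omega)
  have ht0 : 0 < t := by positivity
  have hT : 0 < t ^ 2 := by positivity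
  unfold nodePartsC at h
  dsimp only at h
  split at h
  · rename_i E L hE hL
    split_ifs at h with hP16
    · split at h
      · rename_i E1 E2 C hE1 hE2 hC
        simp only [Option.some.injEq, Prod.mk.injEq] at h
        obtain ⟨rfl, rfl, rfl⟩ := h
        have hLm : MI.mem PREC (Real.log t) L := by
          have := logRatio_mem hL
          rwa [← Real.log_div (by exact_mod_cast hn.ne') (by norm_num), show ((64 : ℕ) : ℝ) = 64 by
            norm_num, ← ht] at this
        -- e^{-π t²}
        have hEm : MI.mem PREC (Real.exp (-Real.pi * t ^ 2)) E := by
          have := MI.mem_exp hS hE (MI.mem_neg (MI.mem_mul hS hP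
            (MI.mem_ofFrac PREC ((n * n : ℕ) : ℤ) (q := 4096) (by norm_num))))
          convert this using 2
          rw [ht]; push_cast; ring
        set q : ℤ := max E.lo 0 with hq
        have hqm := cast_max_zero_mem hEm.1 (by positivity : (0 : ℝ) ≤ Real.exp (-Real.pi * t ^ 2) * PREC)
        have hq0 : 0 ≤ q := hqm.1
        have hqle : (q : ℝ) ≤ Real.exp (-Real.pi * t ^ 2) * PREC := hqm.2
        -- u = 1 + 2q/PREC ≤ θ(t²)
        set u : ℝ := (((PREC : ℤ) + 2 * q : ℤ) : ℝ) / PREC with hu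
        have hq0r : (0 : ℝ) ≤ q := by exact_mod_cast hq0
        have hu1 : 1 ≤ u := by
          rw [hu, le_div_iff₀ hSr]; push_cast; linarith
        have hu0 : 0 < u := by linarith
        have huθ : u ≤ theta (t ^ 2) := by
          have h1 := one_add_le_theta hT
          have : u = 1 + 2 * ((q : ℝ) / PREC) := by rw [hu]; field_simp; push_cast; ring
          rw [this]
          have : (q : ℝ) / PREC ≤ Real.exp (-Real.pi * t ^ 2) := by rw [div_le_iff₀ hSr]; exact hqle
          linarith
        have hu16 : MI.mem PREC (u ^ 16) (MI.sqrIter PREC 4 (MI.ofScaled ((PREC : ℤ) + 2 * q))) := by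
          have := MI.mem_sqrIter hS 4 (MI.mem_ofScaled hS ((PREC : ℤ) + 2 * q))
          rw [← hu] at this
          simpa using this
        set P16 : ℤ := (MI.sqrIter PREC 4 (MI.ofScaled ((PREC : ℤ) + 2 * q))).lo with hP16def
        have hP16r : (0 : ℝ) < P16 := by exact_mod_cast hP16
        have hP16le : (P16 : ℝ) ≤ u ^ 16 * PREC := hu16.1
        have hA0 := (facA_anti_nonneg ht0 le_rfl).2
        have hB0 := (facBC_anti_nonneg ht0 le_rfl).2
        have hC0 := (facC_anti_nonneg ht1 le_rfl ht2).2
        refine ⟨cast_max_zero_mem ?_ (mul_nonneg hA0 hSr.le), cast_max_zero_mem ?_ (mul_nonneg hB0 hSr.le),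
          cast_max_zero_mem ?_ (mul_nonneg hC0 hSr.le)⟩
        · -- a
          have hθ0 : 0 < theta (t ^ 2) := theta_pos hT
          have h1 : (theta (t ^ 2) ^ 16)⁻¹ ≤ (u ^ 16)⁻¹ :=
            inv_anti₀ (pow_pos hu0 16) (pow_le_pow_left₀ hu0.le huθ 16)
          have h2 : (u ^ 16)⁻¹ ≤ (PREC : ℝ) / P16 := by
            rw [inv_eq_one_div, div_le_div_iff₀ (pow_pos hu0 16) hP16r]; linarith
          have h3 : (PREC : ℝ) / P16 ≤ (Numerics.cdiv ((PREC : ℤ) * PREC) P16 : ℝ) / PREC := by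
            rw [le_div_iff₀ hSr]
            have := Numerics.div_le_cdiv (a := (PREC : ℤ) * PREC) hP16
            push_cast at this
            calc (PREC : ℝ) / P16 * PREC = (PREC : ℝ) * PREC / P16 := by ring
              _ ≤ _ := this
          unfold facA
          push_cast
          have : (Numerics.cdiv ((PREC : ℤ) * PREC) P16 : ℝ) ≥ (theta (t ^ 2) ^ 16)⁻¹ * PREC := by
            have := (h1.trans h2).trans h3
            rwa [ge_iff_le, ← le_div_iff₀ hSr]
          linarith
        · -- b
          have m1 := MI.mem_exp hS hE1 (MI.mem_divNat (MI.mem_mulInt hLm (-21)) (n := 20) (by norm_num))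
          have m2 := MI.mem_exp hS hE2 (MI.mem_divNat (MI.mem_mulInt hLm (-339)) (n := 20) (by norm_num))
          have e1 : Real.exp (Real.log t * ((-21 : ℤ) : ℝ) / ((20 : ℕ) : ℝ)) = t ^ (-(21 / 20) : ℝ) := by
            rw [Real.rpow_def_of_pos ht0]; congr 1; push_cast; ring
          have e2 : Real.exp (Real.log t * ((-339 : ℤ) : ℝ) / ((20 : ℕ) : ℝ)) = t ^ (-(339 / 20) : ℝ) := by
            rw [Real.rpow_def_of_pos ht0]; congr 1; push_cast; ring
          rw [e1] at m1
          rw [e2] at m2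
          unfold facBC
          push_cast
          have := m1.1
          have := m2.1
          linarith
        · -- c
          have m := MC.mem_expI hS hP hC hLm
          have := m.1.1
          rw [exp_ofReal_mul_I_re] at this
          unfold facC
          exact this
      · simp at h
  · simp at h

/-- Soundness of `nodeLoC`: `nodeLoC P n ≤ PREC · h_c(n/64)` for `64 ≤ n ≤ 128`. [folklore] -/
private theorem nodeLoC_sound {P : MI} (hP : MI.mem PREC Real.pi P) {n : ℕ} (hn1 : 64 ≤ n)
    (hn2 : n ≤ 128) {v : ℤ} (h : nodeLoC P n = some v) :
    (v : ℝ) ≤ hfunC ((n : ℝ) / 64) * PREC := by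
  have hSr : (0 : ℝ) < PREC := PREC_pos_pair.2
  have hSz : (0 : ℤ) < PREC := by exact_mod_cast PREC_pos_pair.1
  unfold nodeLoC at h
  split at h
  · rename_i a b c hparts
    simp only [Option.some.injEq] at h
    subst h
    obtain ⟨⟨ha0, ha⟩, ⟨hb0, hb⟩, ⟨hc0, hc⟩⟩ := nodePartsC_sound hP hn1 hn2 hparts
    have ha0r : (0 : ℝ) ≤ a := by exact_mod_cast ha0
    have hb0r : (0 : ℝ) ≤ b := by exact_mod_cast hb0
    have hc0r : (0 : ℝ) ≤ c := by exact_mod_cast hc0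
    have hA0 : 0 ≤ facA ((n : ℝ) / 64) * PREC := ha0r.trans ha
    have hB0 : 0 ≤ facBC ((n : ℝ) / 64) * PREC := hb0r.trans hb
    have h1 : ((a * b / (PREC : ℤ) : ℤ) : ℝ) ≤ (a : ℝ) * b / PREC := by
      have := cast_ediv_le_mul_inv (a * b) hSz; push_cast at this; rwa [← div_eq_mul_inv] at this
    have h1' : (0 : ℝ) ≤ ((a * b / (PREC : ℤ) : ℤ) : ℝ) := by
      exact_mod_cast Int.ediv_nonneg (mul_nonneg ha0 hb0) hSz.le
    have h2 : ((a * b / (PREC : ℤ) * c / (PREC : ℤ) : ℤ) : ℝ) ≤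
        ((a * b / (PREC : ℤ) : ℤ) : ℝ) * c / PREC := by
      have := cast_ediv_le_mul_inv (a * b / (PREC : ℤ) * c) hSz; push_cast at this
      rwa [← div_eq_mul_inv] at this
    have h3 : ((a * b / (PREC : ℤ) : ℤ) : ℝ) * c / PREC ≤ ((a : ℝ) * b / PREC) * c / PREC := by
      gcongr
    have h4 : ((a : ℝ) * b / PREC) * c / PREC ≤
        (facA ((n : ℝ) / 64) * PREC) * (facBC ((n : ℝ) / 64) * PREC) / PREC *
          (facC ((n : ℝ) / 64) * PREC) / PREC := by
      gcongr
    have h5 : (facA ((n : ℝ) / 64) * PREC) * (facBC ((n : ℝ) / 64) * PREC) / PREC *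
          (facC ((n : ℝ) / 64) * PREC) / PREC = hfunC ((n : ℝ) / 64) * PREC := by
      unfold hfunC; field_simp
    linarith
  · simp at h

/-- Soundness of `sumLoC`. [folklore] -/
private theorem sumLoC_sound {P : MI} (hP : MI.mem PREC Real.pi P) :
    ∀ (N : ℕ), N ≤ 64 → ∀ {T : ℤ}, sumLoC P N = some T →
      (T : ℝ) ≤ PREC * ∑ i ∈ Finset.range N, hfunC (((65 + i : ℕ) : ℝ) / 64)
  | 0, _, T, h => by
    simp only [sumLoC, Option.some.injEq] at h
    subst h
    simp
  | N + 1, hN, T, h => by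
    unfold sumLoC at h
    split at h
    · rename_i a b ha hb
      simp only [Option.some.injEq] at h
      subst h
      have h1 := sumLoC_sound hP N (by omega) ha
      have h2 := nodeLoC_sound hP (by omega) (by omega) hb
      rw [Finset.sum_range_succ, mul_add]
      push_cast at h1 h2 ⊢
      linarith
    · simp at h

/-- **Soundness of the corner-point certificate**:
`64 · (20/401 + 6380/102161 + 1/1000) ≤ Σ_{i<64} h_c(1 + (i+1)/64)`.
[cite: LagariasRains2003, §7.3 Question 1] -/
theorem certCorner_sound :
    64 * (20 / 401 + 6380 / 102161 + 1 / 1000 : ℝ) ≤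
      ∑ i ∈ Finset.range 64, hfunC (1 + ((i : ℝ) + 1) / 64) := by
  have hc := certCorner_true
  have hSr : (0 : ℝ) < PREC := PREC_pos_pair.2
  unfold certCorner at hc
  split at hc
  · rename_i P hPi
    have hP := MI.mem_pi PREC hPi
    split at hc
    · rename_i T hT
      have hineq := of_decide_eq_true hc
      have hsum := sumLoC_sound hP 64 le_rfl hT
      have hineqr : (64 * (PREC : ℝ)) * (20 * 102161 * 1000 + 6380 * 401 * 1000 +
          401 * 102161) ≤ (T : ℝ) * (401 * 102161 * 1000) := by exact_mod_cast hineq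
      have hnodes : ∑ i ∈ Finset.range 64, hfunC (((65 + i : ℕ) : ℝ) / 64) =
          ∑ i ∈ Finset.range 64, hfunC (1 + ((i : ℝ) + 1) / 64) := by
        refine Finset.sum_congr rfl fun i _ => ?_
        congr 1; push_cast; ring
      rw [hnodes] at hsum
      generalize ∑ i ∈ Finset.range 64, hfunC (1 + ((i : ℝ) + 1) / 64) = Sg at hsum ⊢
      nlinarith
    · simp at hc
  · simp at hc

/-! ## The corner point has `Re Z_ℚ < 0` -/

/-- **`Re Z_ℚ(−16, −1/20 + i) < 0`** (the corner point of the cone). [cite: LagariasRains2003, §7.3 Question 1] -/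
theorem re_ZQ_corner_lt_zero : (ZQ wPt sCorner).re < 0 := by
  have hws : wPt.re < sCorner.re := by norm_num [wPt, sCorner]
  have hs : sCorner.re < 0 := by norm_num [sCorner]
  have h3 : IntegrableOn PhiC (Ioi 1) := integrableOn_thetaPowSubOne_mul hws hs
  have hA : (-1 / sCorner).re = 20 / 401 := by
    rw [show (-1 : ℂ) / sCorner = -(sCorner⁻¹) by rw [neg_div, one_div], neg_re, inv_re]
    simp [sCorner, normSq_mk]
    norm_num
  have hB : (1 / (sCorner - wPt)).re = 6380 / 102161 := by
    have : sCorner - wPt = ⟨319 / 20, 1⟩ := by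
      apply Complex.ext <;> norm_num [sCorner, wPt]
    rw [this, one_div, inv_re]
    simp [normSq_mk]
    norm_num
  have hI : (∫ t in Ioi (1 : ℝ), PhiC t).re = ∫ t in Ioi (1 : ℝ), (PhiC t).re := by
    have := integral_re h3
    simpa using this.symm
  have hI12 : IntegrableOn (fun t => (PhiC t).re) (Ioc 1 2) := (h3.mono_set Ioc_subset_Ioi_self).re
  have hI2 : IntegrableOn (fun t => (PhiC t).re) (Ioi 2) :=
    (h3.mono_set (Ioi_subset_Ioi (by norm_num))).re
  have hsplit : ∫ t in Ioi (1 : ℝ), (PhiC t).re =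
      (∫ t in Ioc (1 : ℝ) 2, (PhiC t).re) + ∫ t in Ioi (2 : ℝ), (PhiC t).re := by
    rw [← setIntegral_union Ioc_disjoint_Ioi_same measurableSet_Ioi hI12 hI2,
      Ioc_union_Ioi_eq_Ioi (by norm_num : (1 : ℝ) ≤ 2)]
  have hmid : ∫ t in Ioc (1 : ℝ) 2, (PhiC t).re = -∫ t in (1 : ℝ)..2, hfunC t := by
    rw [intervalIntegral.integral_of_le (by norm_num : (1 : ℝ) ≤ 2), ← integral_neg]
    exact setIntegral_congr_fun measurableSet_Ioc fun t ht => re_PhiC (zero_lt_one.trans ht.1)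
  have hR := sum_le_integral_hfunC
  have hcert := certCorner_sound
  have htail := integral_tail_PhiC_lt
  have hZ : ZQ wPt sCorner = -1 / sCorner + 1 / (sCorner - wPt) + ∫ t in Ioi (1 : ℝ), PhiC t :=
    ZQ_eq hws hs
  rw [hZ, add_re, add_re, hA, hB, hI, hsplit, hmid]
  linarith

/-- The corner point `(−16, −1/20 + i)` is a point of `C⁻` with `Re Z_ℚ < 0` (so it, too, answers
[LagariasRains2003, §7.3 Question 1] in the negative). [cite: LagariasRains2003, §7.3 Question 1] -/
theorem corner_mem_coneMinus_and_re_ZQ_lt_zero :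
    (wPt, sCorner) ∈ coneMinus ∧ (ZQ wPt sCorner).re < 0 :=
  ⟨corner_mem_coneMinus, re_ZQ_corner_lt_zero⟩

end Literature.NumberTheory.LFunctions.LagariasRains2003
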